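import Mathlib
import Summits.KontsevichZagierPeriods.Zeta5Search.CellStarPencilDischarge
import Summits.KontsevichZagierPeriods.Zeta5Search.CellBridgeDischarge
import Summits.KontsevichZagierPeriods.Zeta5Search.Elimination.DictBridgeLevelOne
import HarnessLib

/-!
# gen-1's wedge dictionary is EQUIVALENT to THREE level-1 values: `explicitPQ ↔ D1 ∧ D2 ∧ D17` (cell `pub-zeta5`, seat ct-1 g18)

HONEST FRAMING: systematic search; no irrationality claim unless certified.  An equivalence between DISPLAYED statements about gen-1's
period dictionary (`WedgeDictionary.explicitPQ` / `wedgeDictionary`, OPEN `@[conjecture]` nodes) and three of its instances; no integral is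
evaluated, no linear form is bounded, nothing about ζ(5), no `γ`, no denominator statement.

OUR work (Summit side).  The D2 end statement of the gen-1 lineage (`Rows.explicitPQ_iff_cells4`; ct-1 g17's hypothesis-free form
`CellStarPencilDischarge.explicitPQ_iff_bridge_data3 : explicitPQ ↔ CellBridge ∧ D1 ∧ D2 ∧ D17`) with the last cellular node discharged by
ct-1 g18's `CellBridgeDischarge.cellBridge_holds : CellBridge`:

* **`explicitPQ_iff_data3`** — gen-1's wedge conjecture `explicitPQ` (for EVERY admissible parameter `a ∈ ℤ⁸`:
  `I(a) = Q(a)(2ζ(5)+4ζ(3)ζ(2)) − 4P̂_d(a)ζ(2) − 2P_d(a)` with the dictionary vector `(Q, P̂_d, P_d)`) is EQUIVALENT to its three instances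
  `ExplicitPQAt (1,0,1,0,1,1,1,1) 1`, `ExplicitPQAt (0,0,1,0,1,1,1,1) 2`, `ExplicitPQAt (0,0,1,0,1,1,0,1) 2` — three identities
  `I(a) = q₀·(2ζ(5)+4ζ(3)ζ(2)) + q₁·ζ(2) + q₂` with explicit rationals `qᵢ` for three 5-fold cellular integrals at level `b₀ = 1`
  (one per `Σ₇`-orbit type of level-1 region points); **`wedgeDictionary_iff_data3`** — the same for `wedgeDictionary`.
* **`explicitPQAt_bridge`** — the BRIDGE step of gen-1 g15's induction ("architecture v3") with NO hypotheses left: `explicitPQ` at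
  `a`, `a − s₇`, `a + e₁ + e₃` gives `explicitPQ` at `a + DS` (`WedgeDictionary.at_bridge` fed with `cellBridge_holds` and fam-elim's
  `Elimination.dictBridge_holds`).

Assembly only (three tree theorems composed); theorems only.  What this file is NOT: a proof of any of the three values (period
computations in `ℚ + ℚζ(2) + ℚ(2ζ(5)+4ζ(2)ζ(3))`), of `explicitPQ`, or of anything about irrationality.
-/

noncomputable section

namespace Summit.KontsevichZagierPeriods.Zeta5Search.WedgeDictionaryData3

open Summit.KontsevichZagierPeriods.Zeta5Search.WedgeDictionary
open Summit.KontsevichZagierPeriods.Zeta5Search.CellStarPencilDischarge (explicitPQ_of_bridge_data3 explicitPQ_iff_bridge_data3)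
open Summit.KontsevichZagierPeriods.Zeta5Search.CellBridgeDischarge (cellBridge_holds)
open Summit.KontsevichZagierPeriods.Zeta5Search.Elimination (dictBridge_holds)

/-- **`explicitPQ` from THREE level-1 values**: `ExplicitPQAt` at `(1,0,1,0,1,1,1,1; 1)`, `(0,0,1,0,1,1,1,1; 2)`, `(0,0,1,0,1,1,0,1; 2)`
imply gen-1's wedge conjecture at every admissible parameter (STAR, PENCIL, BRIDGE, both dictionary nodes, the invariance (27) and
`D16` all being tree theorems). -/
theorem explicitPQ_of_data3 (D1 : ExplicitPQAt ![1, 0, 1, 0, 1, 1, 1, 1] 1) (D2 : ExplicitPQAt ![0, 0, 1, 0, 1, 1, 1, 1] 2)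
    (D17 : ExplicitPQAt ![0, 0, 1, 0, 1, 1, 0, 1] 2) : explicitPQ :=
  explicitPQ_of_bridge_data3 cellBridge_holds D1 D2 D17

/-- **gen-1's wedge conjecture `explicitPQ` is EQUIVALENT to three of its level-1 instances** (hypothesis-free). -/
theorem explicitPQ_iff_data3 :
    explicitPQ ↔
      (ExplicitPQAt ![1, 0, 1, 0, 1, 1, 1, 1] 1 ∧ ExplicitPQAt ![0, 0, 1, 0, 1, 1, 1, 1] 2 ∧ ExplicitPQAt ![0, 0, 1, 0, 1, 1, 0, 1] 2) :=
  ⟨fun h => (explicitPQ_iff_bridge_data3.1 h).2, fun h => explicitPQ_of_data3 h.1 h.2.1 h.2.2⟩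

/-- **The same for the wedge-square dictionary** `WedgeDictionary.wedgeDictionary`
(`I(a) = 2ρ·[(W(b′) − 2ζ(2)U(b′))·F̃₇(b) − (W(b) − 2ζ(2)U(b))·F̃₇(b′)]`): it is EQUIVALENT to the same three level-1 values. -/
theorem wedgeDictionary_iff_data3 :
    wedgeDictionary ↔
      (ExplicitPQAt ![1, 0, 1, 0, 1, 1, 1, 1] 1 ∧ ExplicitPQAt ![0, 0, 1, 0, 1, 1, 1, 1] 2 ∧ ExplicitPQAt ![0, 0, 1, 0, 1, 1, 0, 1] 2) :=
  wedgeDictionary_iff_explicitPQ.trans explicitPQ_iff_data3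

/-- **The BRIDGE induction step, hypothesis-free**: `explicitPQ` at `a`, `a − s₇`, `a + e₁ + e₃` (all four BRIDGE members region points)
gives `explicitPQ` at the apex `a + DS` — gen-1 g15's `at_bridge` with the cellular BRIDGE (`cellBridge_holds`) and the dictionary BRIDGE
(`Elimination.dictBridge_holds`) supplied. -/
theorem explicitPQAt_bridge {a : Fin 8 → ℤ} {j₀ j₁ j₂ j₃ : ℕ}
    (r₀ : RegionHyp a j₀) (r₁ : RegionHyp (a - slotDown 7) j₁) (r₂ : RegionHyp (a + halfUp457) j₂)
    (r₃ : RegionHyp (a + dsUp) j₃) (h₀ : ExplicitPQAt a j₀) (h₁ : ExplicitPQAt (a - slotDown 7) j₁)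
    (h₂ : ExplicitPQAt (a + halfUp457) j₂) : ExplicitPQAt (a + dsUp) j₃ :=
  at_bridge cellBridge_holds dictBridge_holds r₀ r₁ r₂ r₃ h₀ h₁ h₂

end Summit.KontsevichZagierPeriods.Zeta5Search.WedgeDictionaryData3

end
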